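import Summits.QuantumFields.YangMills.Theorems.BalabanUVNodesN15NeumannCubeConvolution
import Summits.QuantumFields.YangMills.Theorems.BalabanUVNodesN15NeumannCubeDefect
import HarnessLib

/-!
# Route «BalabanUVNodes» (K3⁷), node N15 = NE2, -a lane, PROGRAMME N file N-IIk: THE η-DEFECT OF THE CUBE PROPAGATOR BEHIND AN EXPONENTIALLY DECAYING OPERATOR —
# dag-n15-c WANT-n15-a (g12-1) `hasMaj_idef_chiCube_comp_neumannCubeG_of` (the `M_{h_k}∘(aQ*Q − ∂Π∂*)∘G(□)` term of `[Δ_a^{(k)}, M_{h_k}]G_k(□_k)` at TWO spacings)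

Cell `pub-ymgap`, seat `pub-ymgap-dag-n15-a` (KNIT-BY-NAME, g20; D-0062; chair R424 venue; `bears_on: R4∕N15`); `--kind proof --supports stmt-QuantumFields-20544 --as helper`.
Sequel of N-IIi `…N15NeumannCubeConvolution` (ONE operator at ONE spacing behind the images) and N-IIc `…N15NeumannCubeDefect` (the η-defect of the CUT cube); answers dag-n15-c g12
I.30619 WANT-n15-a (g12-1): «the images-shaped two-grid defect of the cube propagator composed with an exponentially decaying operator, ONE row on the doubled torus».

WHAT.  On the doubled-cube torus `M_ν = 2S`, coarse spacing `n = L^k`, fine `n′ = L^r·n`, King's prolongation `P = pull (kingPrV L k r M)` on both sides, `𝔇(A′, A) := A′∘P − P∘A`: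
§26 GENERIC IMAGES CONVOLUTIONS (any spacing, any source norm, any target norm): ★ `hasMaj_comp_of_image` (an operator whose letter is ONE bump `A(y′)·B·e^{−δ₀|reflBlk_T y − y′|}` at a
mirror image, followed by a two-sided `T₁ ≤ a₁e^{−ρ₁d}`: the bump survives one row-sum convolution, `A(y′)·a₁Bc_r·e^{−ρ|y − reflBlk_T y′|}`), ★ `hasMaj_comp_reflSet_images`,
★★ `hasMaj_comp_symOp_images` (`T₁ ∘ Sym ∘ X` for ANY source-localized `X ≤ A(y′)Ce^{−δ₀d}` — N-IIi's `hasMaj_comp_neumannCubeG_images` is the case `X = G∘M_{χ°}`),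
★ `exp_neg_mul_tdistT_reflBlk_le` ∕ ★★ `hasMaj_chiCube_comp_of_image` ∕ `hasMaj_chiCube_comp_of_images` (behind the output cut `χ_□` the images are farther: `1_□1_□·(2^{d+1})B·e^{−ρd}`).
§27 ★★ `idef_chiCube_comp_neumannCubeG` — THE EXACT IDENTITY
  `𝔇(χ′T₁′G′(□), χT₁G(□)) = χ′∘T₁′∘Sym′∘𝔇(G′,G)∘χ + Σ_T χ′∘T₁′∘M_{mask_T}∘P∘R_T∘D∘G∘χ + χ′∘𝔇(T₁′,T₁)∘Sym∘G∘χ`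
(Leibniz for `𝔇` three times, `𝔇(χ′_□, χ_□) = 0`, N-IIa `𝔇(Sym′, Sym) = Σ_T M_{mask_T}∘P∘R_T∘D`, N-IIb `G(□) = Sym∘G∘M_{χ_□}`), and ★★★ `hasMaj_idef_chiCube_comp_neumannCubeG_of` — THE ROW:
from the coarse torus letter `G ≤ Ce^{−δ₀d}` (`hG`), the torus two-grid defect `𝔇(G′, G) ≤ C₀e^{−δ₀d}` (`h0`), the coarse gradients `∇_νG ≤ C₁e^{−δ₀d}` (`h1`), the fine operator's
letter `T₁′ ≤ a₁e^{−ρ₁d}` (`hT′`) and the operators' own defect `𝔇(T₁′, T₁) ≤ r₁e^{−ρ₁d}` (`hDT`), with a row sum `c_r` at rate `σ`, `ρ ≤ δ₀`, `ρ + σ ≤ ρ₁`: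
  `𝔇(χ′_□T₁′G′(□), χ_□T₁G(□)) ≤ 1_□(y)1_□(y′)·2^{d+1}e^{δ₀}c_r·(a₁C₀ + a₁(d+1)C₁∕L^k + r₁C)·e^{−ρ|y−y′|_T}`
— linear in the torus defect `C₀`, in ONE `η = L^{−k}` from the faces, and in the operators' defect `r₁`; NO letter of the coarse `T₁` is needed.  USE (dag-n15-c FILES 72∕73):
`T₁ := M_{h_k}∘(aQ*Q − ∂Π∂*)` at spacing `L^k`, `T₁′` its twin at `L^r·L^k` (`χh = h` frees the output cut), `r₁e^{−ρ₁d}` = their Leibniz of `hfit` and `hasMaj_landauDefect_family`.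
HONEST FRAMING.  Block-majorant bookkeeping (Leibniz for `𝔇`, method of images, one row-sum convolution per image, mirror images are farther behind the cut); no new analytic estimate;
`U ≡ 1` torus MODEL of [B5] §1 on doubled-cube tori `M_ν = 2S`; nothing of [B6] (2.38)–(2.40) ∕ [B9] Thm 3.14 asserted; N15 NOT discharged (object-bound; NE2⁺ NOT PRINTED); counts
UNMOVED (typed 28∕28 · discharged 5∕27); one finite torus pair per index — NOT continuum ∕ ℝ⁴ ∕ OS ∕ mass gap ∕ Clay.  Theorems only (0 def).
-/

noncomputable section

open scoped BigOperators Matrix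
open Finset

namespace Summit.QuantumFields.YangMills.BalabanUVNodes.N15.TwoGrid

open Literature.MathematicalPhysics.QuantumFieldTheory.Balaban1983to89
open Literature.MathematicalPhysics.QuantumFieldTheory.Balaban1983to89.B5Prop11Plancherel (Tor fine unitVec)
open Literature.MathematicalPhysics.QuantumFieldTheory.Balaban1983to89.B6Prop26Gluing (mulOp mulOp_apply ind ind_nonneg ind_le_one)
open Literature.MathematicalPhysics.QuantumFieldTheory.King1986.Torus (blockOf tdistT tdistT_symm tdistT_nonneg)
open Literature.MathematicalPhysics.QuantumFieldTheory.Balaban1983to89.B11SectG (BlockNorm HasMaj)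
open Literature.MathematicalPhysics.QuantumFieldTheory.Balaban1983to89.B6UnitTorusCarrier (unitTorusGeo)
open Literature.MathematicalPhysics.QuantumFieldTheory.Balaban1983to89.T4EtaRateDefect (idef idef_comp)
open Literature.MathematicalPhysics.QuantumFieldTheory.Balaban1983to89.T4EtaRateCoeffDefect (pull pull_apply)
open Summit.QuantumFields.YangMills.BalabanUVNodes.N15.VectorPiece (blkFine kingPrV blkFine_comp_kingPrV)

variable {d : ℕ}

/-! ## §26 Generic images convolutions: one bump at a mirror image survives a row-sum convolution; behind the output cut the images are farther -/

section Images

open Literature.MathematicalPhysics.QuantumFieldTheory.Balaban1983to89.B6RandomWalk (Triangle254)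
open Literature.MathematicalPhysics.QuantumFieldTheory.Balaban1983to89.B11SectG (RowSum hasMaj_comp conv_exp_le)

variable {L : ℕ} {M : Fin (d + 1) → ℕ} [∀ μ, NeZero (M μ)] {k n : ℕ} [NeZero n] {c : Tor M} {S : ℕ}

/-- ★ ONE BUMP AT A MIRROR IMAGE SURVIVES ONE CONVOLUTION: if `W ≤ A(y′)·B·e^{−δ₀|reflBlk_T y − y′|}` (a bump centred at the `T`-image of the source block) and `T₁ ≤ a₁e^{−ρ₁d}`
(two-sided), then `T₁ ∘ W ≤ A(y′)·a₁Bc_r·e^{−ρ|y − reflBlk_T y′|}` (row sum `c_r` at rate `σ`, `ρ ≤ δ₀`, `ρ + σ ≤ ρ₁`).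
[cite: Balaban1984PropagatorsII, (2.37) p.229 (images), Lemma 2.1 (2.61)–(2.62) p.234 (row sums)] -/
theorem hasMaj_comp_of_image {F₁ F₃ : Type} [AddCommGroup F₁] [Module ℝ F₁] [AddCommGroup F₃] [Module ℝ F₃] {b₁ : BlockNorm (unitTorusGeo L k M) F₁} {b₃ : BlockNorm (unitTorusGeo L k M) F₃}
    {W : F₁ →ₗ[ℝ] (Tor (fine n M) × Fin (d + 1) → ℝ)} {T₁ : (Tor (fine n M) × Fin (d + 1) → ℝ) →ₗ[ℝ] F₃} {A : Tor M → ℝ} {B a₁ δ₀ ρ₁ ρ σ cr : ℝ}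
    (htri : Triangle254 (unitTorusGeo L k M)) (hrow : RowSum (unitTorusGeo L k M) σ cr) (hA : ∀ y', 0 ≤ A y') (hB : 0 ≤ B) (ha₁ : 0 ≤ a₁) (hρ : 0 ≤ ρ) (hρδ : ρ ≤ δ₀)
    (hρσ : ρ + σ ≤ ρ₁) (T : Finset (Fin (d + 1)))
    (h₁ : HasMaj (BlockNorm.ofBlocks (unitTorusGeo L k M) (fun b : Tor (fine n M) × Fin (d + 1) => blockOf n M b.1)) b₃ T₁ (fun y y' => a₁ * Real.exp (-(ρ₁ * tdistT M y y'))))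
    (hW : HasMaj b₁ (BlockNorm.ofBlocks (unitTorusGeo L k M) (fun b : Tor (fine n M) × Fin (d + 1) => blockOf n M b.1)) W
      (fun y y' => A y' * (B * Real.exp (-(δ₀ * tdistT M (reflBlk M c T y) y'))))) :
    HasMaj b₁ b₃ (T₁ ∘ₗ W) (fun y y' => A y' * (a₁ * B * cr * Real.exp (-(ρ * tdistT M y (reflBlk M c T y'))))) := by
  have hd : ∀ a b : (unitTorusGeo L k M).Site, 0 ≤ (unitTorusGeo L k M).dist a b := fun a b => tdistT_nonneg M a b
  have h₂ := hW.mono (K' := fun z y' => A y' * (B * Real.exp (-(δ₀ * tdistT M z (reflBlk M c T y'))))) fun z y' => by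
    rw [tdistT_reflBlk_comm]
  refine (hasMaj_comp h₁ h₂ fun y y' => mul_nonneg ha₁ (Real.exp_nonneg _)).mono fun y y' => ?_
  dsimp only
  have hκ : (BlockNorm.ofBlocks (unitTorusGeo L k M) (fun b : Tor (fine n M) × Fin (d + 1) => blockOf n M b.1)).κ = 1 := rfl
  have hconv := conv_exp_le htri hd hrow hρ hρδ hρσ y (reflBlk M c T y')
  calc ∑ z : Tor M, a₁ * Real.exp (-(ρ₁ * tdistT M y z)) *
        ((BlockNorm.ofBlocks (unitTorusGeo L k M) (fun b : Tor (fine n M) × Fin (d + 1) => blockOf n M b.1)).κ *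
          (A y' * (B * Real.exp (-(δ₀ * tdistT M z (reflBlk M c T y'))))))
      = A y' * (a₁ * B) * ∑ z : Tor M, Real.exp (-(ρ₁ * tdistT M y z)) * Real.exp (-(δ₀ * tdistT M z (reflBlk M c T y'))) := by
        rw [hκ, Finset.mul_sum]; exact Finset.sum_congr rfl fun z _ => by ring
    _ ≤ A y' * (a₁ * B) * (cr * Real.exp (-(ρ * tdistT M y (reflBlk M c T y')))) :=
        mul_le_mul_of_nonneg_left hconv (mul_nonneg (hA y') (mul_nonneg ha₁ hB))
    _ = _ := by ring

/-- ★ A MULTI-REFLECTED SOURCE-LOCALIZED OPERATOR BEHIND A DECAYING ONE: `T₁ ∘ R_T ∘ X ≤ A(y′)·a₁(Ce^{δ₀})c_r·e^{−ρ|y − reflBlk_T y′|}` from `X ≤ A(y′)Ce^{−δ₀d}`, `T₁ ≤ a₁e^{−ρ₁d}`.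
[cite: Balaban1984PropagatorsII, (2.37) p.229, Lemma 2.1 (2.61)–(2.62) p.234] -/
theorem hasMaj_comp_reflSet_images {F₁ F₃ : Type} [AddCommGroup F₁] [Module ℝ F₁] [AddCommGroup F₃] [Module ℝ F₃] {b₁ : BlockNorm (unitTorusGeo L k M) F₁}
    {b₃ : BlockNorm (unitTorusGeo L k M) F₃} {X : F₁ →ₗ[ℝ] (Tor (fine n M) × Fin (d + 1) → ℝ)} {T₁ : (Tor (fine n M) × Fin (d + 1) → ℝ) →ₗ[ℝ] F₃} {A : Tor M → ℝ}
    {C a₁ δ₀ ρ₁ ρ σ cr : ℝ} (htri : Triangle254 (unitTorusGeo L k M)) (hrow : RowSum (unitTorusGeo L k M) σ cr) (hA : ∀ y', 0 ≤ A y') (hC : 0 ≤ C) (hδ₀ : 0 ≤ δ₀) (ha₁ : 0 ≤ a₁)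
    (hρ : 0 ≤ ρ) (hρδ : ρ ≤ δ₀) (hρσ : ρ + σ ≤ ρ₁) (T : Finset (Fin (d + 1)))
    (h₁ : HasMaj (BlockNorm.ofBlocks (unitTorusGeo L k M) (fun b : Tor (fine n M) × Fin (d + 1) => blockOf n M b.1)) b₃ T₁ (fun y y' => a₁ * Real.exp (-(ρ₁ * tdistT M y y'))))
    (hX : HasMaj b₁ (BlockNorm.ofBlocks (unitTorusGeo L k M) (fun b : Tor (fine n M) × Fin (d + 1) => blockOf n M b.1)) X
      (fun y y' => A y' * (C * Real.exp (-(δ₀ * tdistT M y y'))))) :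
    HasMaj b₁ b₃ (T₁ ∘ₗ reflSet M n c T ∘ₗ X) (fun y y' => A y' * (a₁ * (C * Real.exp δ₀) * cr * Real.exp (-(ρ * tdistT M y (reflBlk M c T y'))))) :=
  hasMaj_comp_of_image htri hrow hA (by positivity) ha₁ hρ hρδ hρσ T h₁ (hasMaj_reflSet_comp_images hA hC hδ₀ T hX)

/-- ★★ **A SYMMETRISED SOURCE-LOCALIZED OPERATOR BEHIND A DECAYING ONE — THE IMAGES KERNEL SURVIVES ONE CONVOLUTION** (any source∕target norm, any spacing): from `X ≤ A(y′)Ce^{−δ₀d}` and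
`T₁ ≤ a₁e^{−ρ₁d}`, `T₁ ∘ Sym ∘ X ≤ A(y′)·a₁(Ce^{δ₀})c_r·Σ_T e^{−ρ|y − reflBlk_T y′|}` (N-IIi `hasMaj_comp_neumannCubeG_images` is `X = G∘M_{χ°}`, `A = 1_□`).
[cite: Balaban1984PropagatorsII, (2.37) p.229 (images), Lemma 2.1 (2.61)–(2.62) p.234 (row sums)] -/
theorem hasMaj_comp_symOp_images {F₁ F₃ : Type} [AddCommGroup F₁] [Module ℝ F₁] [AddCommGroup F₃] [Module ℝ F₃] {b₁ : BlockNorm (unitTorusGeo L k M) F₁}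
    {b₃ : BlockNorm (unitTorusGeo L k M) F₃} {X : F₁ →ₗ[ℝ] (Tor (fine n M) × Fin (d + 1) → ℝ)} {T₁ : (Tor (fine n M) × Fin (d + 1) → ℝ) →ₗ[ℝ] F₃} {A : Tor M → ℝ}
    {C a₁ δ₀ ρ₁ ρ σ cr : ℝ} (htri : Triangle254 (unitTorusGeo L k M)) (hrow : RowSum (unitTorusGeo L k M) σ cr) (hA : ∀ y', 0 ≤ A y') (hC : 0 ≤ C) (hδ₀ : 0 ≤ δ₀) (ha₁ : 0 ≤ a₁)
    (hρ : 0 ≤ ρ) (hρδ : ρ ≤ δ₀) (hρσ : ρ + σ ≤ ρ₁)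
    (h₁ : HasMaj (BlockNorm.ofBlocks (unitTorusGeo L k M) (fun b : Tor (fine n M) × Fin (d + 1) => blockOf n M b.1)) b₃ T₁ (fun y y' => a₁ * Real.exp (-(ρ₁ * tdistT M y y'))))
    (hX : HasMaj b₁ (BlockNorm.ofBlocks (unitTorusGeo L k M) (fun b : Tor (fine n M) × Fin (d + 1) => blockOf n M b.1)) X
      (fun y y' => A y' * (C * Real.exp (-(δ₀ * tdistT M y y'))))) :
    HasMaj b₁ b₃ (T₁ ∘ₗ symOp M n c ∘ₗ X)
      (fun y y' => A y' * (a₁ * (C * Real.exp δ₀) * cr * ∑ T ∈ (Finset.univ : Finset (Fin (d + 1))).powerset, Real.exp (-(ρ * tdistT M y (reflBlk M c T y'))))) := by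
  have hsplit : T₁ ∘ₗ symOp M n c ∘ₗ X = ∑ T ∈ (Finset.univ : Finset (Fin (d + 1))).powerset, T₁ ∘ₗ reflSet M n c T ∘ₗ X := by
    rw [symOp, fsum_comp, comp_fsum]
  rw [hsplit]
  refine (hasMaj_finsum _ _ _ fun T _ => hasMaj_comp_reflSet_images htri hrow hA hC hδ₀ ha₁ hρ hρδ hρσ T h₁ hX).mono fun y y' => le_of_eq ?_
  rw [Finset.mul_sum, Finset.mul_sum]

/-- ★ behind the output cut a mirror image of a cube block is farther than the block: `y, y′ ∈ □ ⟹ e^{−ρ|y − reflBlk_T y′|} ≤ e^{−ρ|y − y′|}` (`M_ν = 2S`, `ρ ≥ 0`).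
[cite: Balaban1984PropagatorsII, (2.37) p.229] -/
theorem exp_neg_mul_tdistT_reflBlk_le (hM : ∀ ν, M ν = 2 * S) {ρ : ℝ} (hρ : 0 ≤ ρ) {y y' : Tor M} (hy : y ∈ cubeBlocks M c S) (hy' : y' ∈ cubeBlocks M c S)
    (T : Finset (Fin (d + 1))) : Real.exp (-(ρ * tdistT M y (reflBlk M c T y'))) ≤ Real.exp (-(ρ * tdistT M y y')) := by
  refine Real.exp_le_exp.mpr ?_
  have := tdistT_le_tdistT_reflBlk (c := c) hM hy' hy T
  rw [tdistT_symm M y' y, tdistT_symm M (reflBlk M c T y') y] at this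
  nlinarith

/-- ★★ **BEHIND THE OUTPUT CUT ONE IMAGE BUMP IS A TWO-SIDED LETTER**: `W ≤ 1_□(y′)·B·e^{−ρ|y − reflBlk_T y′|} ⟹ χ_□ ∘ W ≤ 1_□(y)1_□(y′)·B·e^{−ρ|y−y′|}` (`M_ν = 2S`).
[cite: Balaban1984PropagatorsII, (2.37) p.229, (2.133)–(2.134) p.247 (shapes)] -/
theorem hasMaj_chiCube_comp_of_image {F₁ : Type} [AddCommGroup F₁] [Module ℝ F₁] {b₁ : BlockNorm (unitTorusGeo L k M) F₁} {W : F₁ →ₗ[ℝ] (Tor (fine n M) × Fin (d + 1) → ℝ)}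
    {B ρ : ℝ} (hM : ∀ ν, M ν = 2 * S) (hB : 0 ≤ B) (hρ : 0 ≤ ρ) (T : Finset (Fin (d + 1)))
    (hW : HasMaj b₁ (BlockNorm.ofBlocks (unitTorusGeo L k M) (fun b : Tor (fine n M) × Fin (d + 1) => blockOf n M b.1)) W
      (fun y y' => ind (cubeBlocks M c S : Set (Tor M)) y' * (B * Real.exp (-(ρ * tdistT M y (reflBlk M c T y')))))) :
    HasMaj b₁ (BlockNorm.ofBlocks (unitTorusGeo L k M) (fun b : Tor (fine n M) × Fin (d + 1) => blockOf n M b.1)) (mulOp (chiCube M n c S) ∘ₗ W)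
      (fun y y' => ind (cubeBlocks M c S : Set (Tor M)) y * ind (cubeBlocks M c S : Set (Tor M)) y' * (B * Real.exp (-(ρ * tdistT M y y')))) := by
  have h := hasMaj_mulOp_chiCube_comp (c := c) (S := S) (fun y y' => mul_nonneg (ind_nonneg _ _) (mul_nonneg hB (Real.exp_nonneg _))) hW
  refine h.mono fun y y' => ?_
  by_cases hy : y ∈ cubeBlocks M c S
  · by_cases hy' : y' ∈ cubeBlocks M c S
    · have hi : ind (cubeBlocks M c S : Set (Tor M)) y = 1 := by simp [ind, hy]
      have hi' : ind (cubeBlocks M c S : Set (Tor M)) y' = 1 := by simp [ind, hy']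
      simp only [hi, hi', one_mul]
      exact mul_le_mul_of_nonneg_left (exp_neg_mul_tdistT_reflBlk_le hM hρ hy hy' T) hB
    · have hi' : ind (cubeBlocks M c S : Set (Tor M)) y' = 0 := by simp [ind, hy']
      rw [hi']; simp
  · have hi : ind (cubeBlocks M c S : Set (Tor M)) y = 0 := by simp [ind, hy]
    rw [hi]; simp

/-- ★★ **BEHIND THE OUTPUT CUT THE IMAGES KERNEL IS A TWO-SIDED LETTER**: `W ≤ 1_□(y′)·B·Σ_T e^{−ρ|y − reflBlk_T y′|} ⟹ χ_□ ∘ W ≤ 1_□(y)1_□(y′)·2^{d+1}B·e^{−ρ|y−y′|}` (`M_ν = 2S`).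
[cite: Balaban1984PropagatorsII, (2.37) p.229, (2.133)–(2.134) p.247 (shapes)] -/
theorem hasMaj_chiCube_comp_of_images {F₁ : Type} [AddCommGroup F₁] [Module ℝ F₁] {b₁ : BlockNorm (unitTorusGeo L k M) F₁} {W : F₁ →ₗ[ℝ] (Tor (fine n M) × Fin (d + 1) → ℝ)}
    {B ρ : ℝ} (hM : ∀ ν, M ν = 2 * S) (hB : 0 ≤ B) (hρ : 0 ≤ ρ)
    (hW : HasMaj b₁ (BlockNorm.ofBlocks (unitTorusGeo L k M) (fun b : Tor (fine n M) × Fin (d + 1) => blockOf n M b.1)) W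
      (fun y y' => ind (cubeBlocks M c S : Set (Tor M)) y' * (B * ∑ T ∈ (Finset.univ : Finset (Fin (d + 1))).powerset, Real.exp (-(ρ * tdistT M y (reflBlk M c T y')))))) :
    HasMaj b₁ (BlockNorm.ofBlocks (unitTorusGeo L k M) (fun b : Tor (fine n M) × Fin (d + 1) => blockOf n M b.1)) (mulOp (chiCube M n c S) ∘ₗ W)
      (fun y y' => ind (cubeBlocks M c S : Set (Tor M)) y * ind (cubeBlocks M c S : Set (Tor M)) y' * (2 ^ (d + 1) * B * Real.exp (-(ρ * tdistT M y y')))) := by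
  have h := hasMaj_mulOp_chiCube_comp (c := c) (S := S) (fun y y' => mul_nonneg (ind_nonneg _ _) (mul_nonneg hB
    (Finset.sum_nonneg fun _ _ => Real.exp_nonneg _))) hW
  refine h.mono fun y y' => ?_
  by_cases hy : y ∈ cubeBlocks M c S
  · by_cases hy' : y' ∈ cubeBlocks M c S
    · have hi : ind (cubeBlocks M c S : Set (Tor M)) y = 1 := by simp [ind, hy]
      have hi' : ind (cubeBlocks M c S : Set (Tor M)) y' = 1 := by simp [ind, hy']
      have hsumT : ∑ T ∈ (Finset.univ : Finset (Fin (d + 1))).powerset, Real.exp (-(ρ * tdistT M y (reflBlk M c T y'))) ≤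
          2 ^ (d + 1) * Real.exp (-(ρ * tdistT M y y')) :=
        calc ∑ T ∈ (Finset.univ : Finset (Fin (d + 1))).powerset, Real.exp (-(ρ * tdistT M y (reflBlk M c T y')))
            ≤ ∑ T ∈ (Finset.univ : Finset (Fin (d + 1))).powerset, Real.exp (-(ρ * tdistT M y y')) :=
              Finset.sum_le_sum fun T _ => exp_neg_mul_tdistT_reflBlk_le hM hρ hy hy' T
          _ = 2 ^ (d + 1) * Real.exp (-(ρ * tdistT M y y')) := by
              rw [Finset.sum_const, Finset.card_powerset, Finset.card_univ, Fintype.card_fin, nsmul_eq_mul]; push_cast; ring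
      simp only [hi, hi', one_mul]
      calc B * ∑ T ∈ (Finset.univ : Finset (Fin (d + 1))).powerset, Real.exp (-(ρ * tdistT M y (reflBlk M c T y')))
          ≤ B * (2 ^ (d + 1) * Real.exp (-(ρ * tdistT M y y'))) := mul_le_mul_of_nonneg_left hsumT hB
        _ = 2 ^ (d + 1) * B * Real.exp (-(ρ * tdistT M y y')) := by ring
    · have hi' : ind (cubeBlocks M c S : Set (Tor M)) y' = 0 := by simp [ind, hy']
      rw [hi']; simp
  · have hi : ind (cubeBlocks M c S : Set (Tor M)) y = 0 := by simp [ind, hy]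
    rw [hi]; simp

end Images

/-! ## §27 The η-defect of the cube propagator behind an exponentially decaying operator: the exact identity and THE ROW -/

section Row

open Literature.MathematicalPhysics.QuantumFieldTheory.Balaban1983to89.B6RandomWalk (Triangle254)
open Literature.MathematicalPhysics.QuantumFieldTheory.Balaban1983to89.B11SectG (RowSum)

variable {L : ℕ} [NeZero L] {M : Fin (d + 1) → ℕ} [∀ μ, NeZero (M μ)] {k r : ℕ} {c : Tor M} {S : ℕ}

/-- ★★ **THE η-DEFECT OF THE CUBE PROPAGATOR BEHIND AN OPERATOR, EXACTLY**: with `N = G(□ + c)` at spacing `L^k`, `N′` at `L^r·L^k`, `P` King's prolongation on both sides,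
`𝔇(χ′_□T₁′N′, χ_□T₁N) = χ′_□∘T₁′∘Sym′∘𝔇(G′, G)∘χ_□ + Σ_T χ′_□∘T₁′∘M_{mask_T}∘P∘R_T∘D∘G∘χ_□ + χ′_□∘𝔇(T₁′, T₁)∘Sym∘G∘χ_□` — Leibniz for `𝔇`, `𝔇(χ′_□, χ_□) = 0`, the
symmetriser's defect (N-IIa §13: `2^{d+1}` masked reflected own-direction coarse differences), `G(□) = Sym∘G∘M_{χ_□}` (N-IIb §14).  No letter is used.
[cite: Balaban1985BackgroundPropagators, Thm 3.14 pp.426–427 (difference template); Balaban1984PropagatorsII, (2.37) p.229 (Neumann cubes by images)] -/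
theorem idef_chiCube_comp_neumannCubeG (hM : ∀ ν, M ν = 2 * S) {a : ℝ} (ha : 0 < a)
    (T₁ : (Tor (fine (L ^ k) M) × Fin (d + 1) → ℝ) →ₗ[ℝ] (Tor (fine (L ^ k) M) × Fin (d + 1) → ℝ))
    (T₁' : (Tor (fine (L ^ r * L ^ k) M) × Fin (d + 1) → ℝ) →ₗ[ℝ] (Tor (fine (L ^ r * L ^ k) M) × Fin (d + 1) → ℝ)) :
    idef (pull (kingPrV L k r M)) (pull (kingPrV L k r M))
        (mulOp (chiCube M (L ^ r * L ^ k) c S) ∘ₗ T₁' ∘ₗ neumannCubeG M (L ^ r * L ^ k) c S a) (mulOp (chiCube M (L ^ k) c S) ∘ₗ T₁ ∘ₗ neumannCubeG M (L ^ k) c S a) =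
      mulOp (chiCube M (L ^ r * L ^ k) c S) ∘ₗ
        (T₁' ∘ₗ (symOp M (L ^ r * L ^ k) c ∘ₗ (idef (pull (kingPrV L k r M)) (pull (kingPrV L k r M)) (gOp M (L ^ r * L ^ k) a) (gOp M (L ^ k) a) ∘ₗ mulOp (chiCube M (L ^ k) c S)) +
            (∑ T ∈ (Finset.univ : Finset (Fin (d + 1))).powerset,
                mulOp (faceMask M (L ^ r * L ^ k) (L ^ r) T) ∘ₗ pull (kingPrV L k r M) ∘ₗ reflSet M (L ^ k) c T ∘ₗ ownDiff M (L ^ k)) ∘ₗ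
              (gOp M (L ^ k) a ∘ₗ mulOp (chiCube M (L ^ k) c S))) +
          idef (pull (kingPrV L k r M)) (pull (kingPrV L k r M)) T₁' T₁ ∘ₗ (symOp M (L ^ k) c ∘ₗ gOp M (L ^ k) a ∘ₗ mulOp (chiCube M (L ^ k) c S))) := by
  have hL0 : 0 < L := Nat.pos_of_ne_zero (NeZero.ne L)
  have hn : 1 ≤ L ^ k := Nat.one_le_pow _ _ hL0
  have hn' : 1 ≤ L ^ r * L ^ k := Nat.one_le_iff_ne_zero.mpr (Nat.mul_ne_zero (pow_ne_zero r (NeZero.ne L)) (by positivity))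
  rw [neumannCubeG_eq_chiCube M (L ^ r * L ^ k) c S a hM hn' ha, neumannCubeG_eq_chiCube M (L ^ k) c S a hM hn ha, idef_comp, idef_mulOp_chiCube,
    LinearMap.zero_comp, add_zero, idef_comp, idef_comp, idef_comp, idef_mulOp_chiCube, LinearMap.comp_zero, zero_add, idef_symOp_kingPrV]

/-- ★★★ **THE η-DEFECT OF THE CUBE PROPAGATOR BEHIND AN EXPONENTIALLY DECAYING OPERATOR — dag-n15-c WANT-n15-a (g12-1)** (any torus `M_ν = 2S`, coarse `n = L^k`, fine `n′ = L^r·n`,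
King's prolongation `P` on both sides).  INPUT LETTERS (N-IIc `_of` convention, one decay rate `δ₀` for the torus data, `ρ₁` for the operators): the coarse torus propagator `G ≤ Ce^{−δ₀d}`
(`hG`), the torus two-grid defect `𝔇(G′, G) ≤ C₀e^{−δ₀d}` (`h0`), the coarse gradients `∇_νG ≤ C₁e^{−δ₀d}` (`h1`, `η⁻¹`-normalised), the FINE operator `T₁′ ≤ a₁e^{−ρ₁d}` (`hT′`) and
the operators' defect `𝔇(T₁′, T₁) ≤ r₁e^{−ρ₁d}` (`hDT`); a row sum `c_r` at rate `σ` with `ρ ≤ δ₀`, `ρ + σ ≤ ρ₁`.  OUTPUT: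
`𝔇(χ′_□∘T₁′∘G′(□), χ_□∘T₁∘G(□)) ≤ 1_□(y)1_□(y′)·2^{d+1}e^{δ₀}c_r·(a₁C₀ + a₁(d+1)C₁∕L^k + r₁C)·e^{−ρ|y−y′|_T}` — linear in `C₀`, in one `η = L^{−k}` (the faces of the
symmetriser's defect) and in `r₁`; the coarse operator `T₁` enters only through `𝔇(T₁′, T₁)`.
[cite: Balaban1985BackgroundPropagators, Thm 3.14 pp.426–427 (difference template), (3.42) p.397 (shape); Balaban1984PropagatorsII, (2.37) p.229 (images), Lemma 2.1 (2.61)–(2.62) p.234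
(row sums), (2.133)–(2.134) p.247 (shapes); Balaban1984PropagatorsI, (1.126)–(1.128) p.38] -/
theorem hasMaj_idef_chiCube_comp_neumannCubeG_of (hM : ∀ ν, M ν = 2 * S) {a : ℝ} (ha : 0 < a) {C C₀ C₁ δ₀ a₁ r₁ ρ₁ ρ σ cr : ℝ}
    (htri : Triangle254 (unitTorusGeo L k M)) (hrow : RowSum (unitTorusGeo L k M) σ cr) (hC : 0 ≤ C) (hC₀ : 0 ≤ C₀) (hC₁ : 0 ≤ C₁) (hδ₀ : 0 ≤ δ₀) (ha₁ : 0 ≤ a₁) (hr₁ : 0 ≤ r₁)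
    (hρ : 0 ≤ ρ) (hρδ : ρ ≤ δ₀) (hρσ : ρ + σ ≤ ρ₁)
    {T₁ : (Tor (fine (L ^ k) M) × Fin (d + 1) → ℝ) →ₗ[ℝ] (Tor (fine (L ^ k) M) × Fin (d + 1) → ℝ)}
    {T₁' : (Tor (fine (L ^ r * L ^ k) M) × Fin (d + 1) → ℝ) →ₗ[ℝ] (Tor (fine (L ^ r * L ^ k) M) × Fin (d + 1) → ℝ)}
    (hG : HasMaj (BlockNorm.ofBlocks (unitTorusGeo L k M) (fun b : Tor (fine (L ^ k) M) × Fin (d + 1) => blockOf (L ^ k) M b.1))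
      (BlockNorm.ofBlocks (unitTorusGeo L k M) (fun b : Tor (fine (L ^ k) M) × Fin (d + 1) => blockOf (L ^ k) M b.1)) (gOp M (L ^ k) a)
      (fun y y' => C * Real.exp (-(δ₀ * tdistT M y y'))))
    (h0 : HasMaj (BlockNorm.ofBlocks (unitTorusGeo L k M) (fun b : Tor (fine (L ^ k) M) × Fin (d + 1) => blockOf (L ^ k) M b.1))
      (BlockNorm.ofBlocks (unitTorusGeo L k M) (fun b' : Tor (fine (L ^ r * L ^ k) M) × Fin (d + 1) => blockOf (L ^ r * L ^ k) M b'.1))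
      (idef (pull (kingPrV L k r M)) (pull (kingPrV L k r M)) (gOp M (L ^ r * L ^ k) a) (gOp M (L ^ k) a)) (fun y y' => C₀ * Real.exp (-(δ₀ * tdistT M y y'))))
    (h1 : ∀ ν, HasMaj (BlockNorm.ofBlocks (unitTorusGeo L k M) (fun b : Tor (fine (L ^ k) M) × Fin (d + 1) => blockOf (L ^ k) M b.1))
      (BlockNorm.ofBlocks (unitTorusGeo L k M) (fun b : Tor (fine (L ^ k) M) × Fin (d + 1) => blockOf (L ^ k) M b.1))
      (symbOp M (L ^ k) (sD M (L ^ k) ν ((L ^ k : ℕ) : ℝ)) ∘ₗ gOp M (L ^ k) a) (fun y y' => C₁ * Real.exp (-(δ₀ * tdistT M y y'))))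
    (hT' : HasMaj (BlockNorm.ofBlocks (unitTorusGeo L k M) (fun b' : Tor (fine (L ^ r * L ^ k) M) × Fin (d + 1) => blockOf (L ^ r * L ^ k) M b'.1))
      (BlockNorm.ofBlocks (unitTorusGeo L k M) (fun b' : Tor (fine (L ^ r * L ^ k) M) × Fin (d + 1) => blockOf (L ^ r * L ^ k) M b'.1)) T₁'
      (fun y y' => a₁ * Real.exp (-(ρ₁ * tdistT M y y'))))
    (hDT : HasMaj (BlockNorm.ofBlocks (unitTorusGeo L k M) (fun b : Tor (fine (L ^ k) M) × Fin (d + 1) => blockOf (L ^ k) M b.1))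
      (BlockNorm.ofBlocks (unitTorusGeo L k M) (fun b' : Tor (fine (L ^ r * L ^ k) M) × Fin (d + 1) => blockOf (L ^ r * L ^ k) M b'.1))
      (idef (pull (kingPrV L k r M)) (pull (kingPrV L k r M)) T₁' T₁) (fun y y' => r₁ * Real.exp (-(ρ₁ * tdistT M y y')))) :
    HasMaj (BlockNorm.ofBlocks (unitTorusGeo L k M) (fun b : Tor (fine (L ^ k) M) × Fin (d + 1) => blockOf (L ^ k) M b.1))
      (BlockNorm.ofBlocks (unitTorusGeo L k M) (fun b' : Tor (fine (L ^ r * L ^ k) M) × Fin (d + 1) => blockOf (L ^ r * L ^ k) M b'.1))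
      (idef (pull (kingPrV L k r M)) (pull (kingPrV L k r M))
        (mulOp (chiCube M (L ^ r * L ^ k) c S) ∘ₗ T₁' ∘ₗ neumannCubeG M (L ^ r * L ^ k) c S a) (mulOp (chiCube M (L ^ k) c S) ∘ₗ T₁ ∘ₗ neumannCubeG M (L ^ k) c S a))
      (fun y y' => ind (cubeBlocks M c S : Set (Tor M)) y * ind (cubeBlocks M c S : Set (Tor M)) y' *
        ((2 ^ (d + 1) * Real.exp δ₀ * cr * (a₁ * C₀ + a₁ * ((d + 1) * (C₁ / (L ^ k : ℕ))) + r₁ * C)) * Real.exp (-(ρ * tdistT M y y')))) := by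
  have hcr : 0 ≤ cr := hrow.nonneg (c : Tor M)
  -- distribute the exact identity into the three terms
  have hid := idef_chiCube_comp_neumannCubeG (c := c) (S := S) hM ha T₁ T₁'
  rw [LinearMap.comp_add, LinearMap.comp_add, LinearMap.comp_add, fsum_comp, comp_fsum, comp_fsum] at hid
  rw [hid]
  -- TERM A1: the torus two-grid defect, source-cut, symmetrised on the fine lattice, behind `T₁′`, output-cut
  have hX0 := hasMaj_comp_mulOp_chiCube (c := c) (S := S) (fun y y' => mul_nonneg hC₀ (Real.exp_nonneg _)) h0
  have hA1 := hasMaj_chiCube_comp_of_images (c := c) (S := S) hM (by positivity : (0 : ℝ) ≤ a₁ * (C₀ * Real.exp δ₀) * cr) hρ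
    (hasMaj_comp_symOp_images (c := c) htri hrow (fun _ => ind_nonneg _ _) hC₀ hδ₀ ha₁ hρ hρδ hρσ hT' hX0)
  -- TERM A2: the `2^{d+1}` face terms: one own-direction coarse difference of `G`, source-cut, reflected, pulled back, masked, behind `T₁′`, output-cut
  have hblk : ∀ x : Tor (fine (L ^ r * L ^ k) M) × Fin (d + 1), blockOf (L ^ k) M (kingPrV L k r M x).1 = blockOf (L ^ r * L ^ k) M x.1 := fun x =>
    congrFun (blkFine_comp_kingPrV M L k r) x
  have hD := hasMaj_ownDiff_comp hC₁ h1
  have hX : HasMaj (BlockNorm.ofBlocks (unitTorusGeo L k M) (fun b : Tor (fine (L ^ k) M) × Fin (d + 1) => blockOf (L ^ k) M b.1))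
      (BlockNorm.ofBlocks (unitTorusGeo L k M) (fun b : Tor (fine (L ^ k) M) × Fin (d + 1) => blockOf (L ^ k) M b.1))
      (ownDiff M (L ^ k) ∘ₗ gOp M (L ^ k) a ∘ₗ mulOp (chiCube M (L ^ k) c S))
      (fun y y' => ind (cubeBlocks M c S : Set (Tor M)) y' * ((d + 1) * (C₁ / (L ^ k : ℕ)) * Real.exp (-(δ₀ * tdistT M y y')))) :=
    (hasMaj_comp_mulOp_chiCube (c := c) (S := S) (fun y y' => by positivity) hD).congr fun μ => rfl
  have hA2 : ∀ T : Finset (Fin (d + 1)),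
      HasMaj (BlockNorm.ofBlocks (unitTorusGeo L k M) (fun b : Tor (fine (L ^ k) M) × Fin (d + 1) => blockOf (L ^ k) M b.1))
        (BlockNorm.ofBlocks (unitTorusGeo L k M) (fun b' : Tor (fine (L ^ r * L ^ k) M) × Fin (d + 1) => blockOf (L ^ r * L ^ k) M b'.1))
        (mulOp (chiCube M (L ^ r * L ^ k) c S) ∘ₗ T₁' ∘ₗ
          (mulOp (faceMask M (L ^ r * L ^ k) (L ^ r) T) ∘ₗ pull (kingPrV L k r M) ∘ₗ reflSet M (L ^ k) c T ∘ₗ ownDiff M (L ^ k)) ∘ₗ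
            (gOp M (L ^ k) a ∘ₗ mulOp (chiCube M (L ^ k) c S)))
        (fun y y' => ind (cubeBlocks M c S : Set (Tor M)) y * ind (cubeBlocks M c S : Set (Tor M)) y' *
          (a₁ * ((d + 1) * (C₁ / (L ^ k : ℕ)) * Real.exp δ₀) * cr * Real.exp (-(ρ * tdistT M y y')))) := by
    intro T
    have hc₁ : (0 : ℝ) ≤ (d + 1) * (C₁ / (L ^ k : ℕ)) := by positivity
    have hK0 : ∀ y y' : Tor M, 0 ≤ ind (g := unitTorusGeo L k M) (cubeBlocks M c S : Set (Tor M)) y' *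
        ((d + 1) * (C₁ / (L ^ k : ℕ)) * Real.exp δ₀ * Real.exp (-(δ₀ * tdistT M (reflBlk M c T y) y'))) := fun y y' => mul_nonneg (ind_nonneg _ _) (by positivity)
    -- reflect, pull back along King's map (blocks are preserved), mask (`|mask| ≤ 1`)
    have hR := hasMaj_reflSet_comp_images (c := c) (fun _ => ind_nonneg _ _) hc₁ hδ₀ T hX
    have hP := hasMaj_pull_comp₂ (g := unitTorusGeo L k M) (fun b : Tor (fine (L ^ k) M) × Fin (d + 1) => blockOf (L ^ k) M b.1)
      (fun b' : Tor (fine (L ^ r * L ^ k) M) × Fin (d + 1) => blockOf (L ^ r * L ^ k) M b'.1) (kingPrV L k r M) hK0 (fun x y' => by rw [hblk x]) hR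
    have hZ := hasMaj_mulOp_comp_of_abs_le_one _ (abs_faceMask_le_one (M := M) (n := L ^ r * L ^ k) (L ^ r) T) hK0 hP
    have hW := hasMaj_comp_of_image (c := c) htri hrow (fun _ => ind_nonneg _ _) (by positivity : (0 : ℝ) ≤ (d + 1) * (C₁ / (L ^ k : ℕ)) * Real.exp δ₀) ha₁ hρ hρδ hρσ T hT' hZ
    exact (hasMaj_chiCube_comp_of_image (c := c) (S := S) hM (by positivity) hρ T hW).congr fun μ => rfl
  have hA2s := hasMaj_finsum (Finset.univ : Finset (Fin (d + 1))).powerset _ _ fun T _ => hA2 T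
  -- TERM B: the operators' defect behind the symmetrised source-cut coarse propagator, output-cut
  have hXG := hasMaj_comp_mulOp_chiCube (c := c) (S := S) (fun y y' => mul_nonneg hC (Real.exp_nonneg _)) hG
  have hB := hasMaj_chiCube_comp_of_images (c := c) (S := S) hM (by positivity : (0 : ℝ) ≤ r₁ * (C * Real.exp δ₀) * cr) hρ
    (hasMaj_comp_symOp_images (c := c) htri hrow (fun _ => ind_nonneg _ _) hC hδ₀ hr₁ hρ hρδ hρσ hDT hXG)
  refine ((hA1.add hA2s).add hB).mono fun y y' => le_of_eq ?_
  rw [Finset.sum_const, Finset.card_powerset, Finset.card_univ, Fintype.card_fin, nsmul_eq_mul]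
  push_cast
  ring

end Row

end Summit.QuantumFields.YangMills.BalabanUVNodes.N15.TwoGrid
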